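import Mathlib
import Literature.Geometry.Symplectic.JHolomorphicMap
import Summits.SmoothPoincare4.SmoothPoincare4.Theorems.SullivanDualTameOrBrodyR4AprioriCalculus
import Summits.SmoothPoincare4.SmoothPoincare4.Theorems.SullivanDualTameOrBrodyR4AprioriEnergy

/-!
# A-priori estimate for `J`-holomorphic maps: part 6, step γ

Helper file of the lead (c2) for stub `stub_aprioriOf` of line `Sketch`, crux `TameOrBrodyR4`
(stmt-SmoothPoincare4-7826, route SullivanDual). Step γ of the bootstrapping (registered sub-goal `gamma`): a sup bound `‖Dⁿg(z)‖ ≤ C (1 + ∫_{D_ρ} ‖D^{n+2}g‖² + ∫_{D_ρ} ‖D^{n+1}g‖² + ∫_{D_ρ} ‖Dⁿg‖²)` on a smaller disc, from the sup bound of stub `stub_supBound` applied to the localised words.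
-/

noncomputable section

open scoped ContDiff Topology Nat
open Filter Set Literature.Geometry.Symplectic

-- the registered namespace `Summit.SmoothPoincare4.SmoothPoincare4.…` repeats a component
set_option linter.dupNamespace false

namespace Summit.SmoothPoincare4.SmoothPoincare4.Cruxes.TameOrBrodyR4.Sketch

/-- Local notation for the model space `ℝ⁴ = EuclideanSpace ℝ (Fin 4)`. -/
local notation "E4" => EuclideanSpace ℝ (Fin 4)

namespace Apriori

/-! ### Step γ: a sup bound from `L²` bounds of two more derivatives -/

section Gamma

open MeasureTheory Metric

/-- Second derivatives of a localised map `χ • w`. -/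
theorem fderiv_fderiv_smul {G : Type*} [NormedAddCommGroup G] [NormedSpace ℝ G] {χ : ℂ → ℝ}
    {w : ℂ → G} (hχ : ContDiff ℝ ∞ χ) (hw : ContDiff ℝ ∞ w) (z u v : ℂ) :
    fderiv ℝ (fderiv ℝ (fun t => χ t • w t) · u) z v =
      χ z • fderiv ℝ (fderiv ℝ w · u) z v + fderiv ℝ χ z v • fderiv ℝ w z u +
        (fderiv ℝ χ z u • fderiv ℝ w z v + fderiv ℝ (fderiv ℝ χ · u) z v • w z) := by
  have h1 : (fderiv ℝ (fun t => χ t • w t) · u) =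
      (fun t => χ t • fderiv ℝ w t u) + fun t => fderiv ℝ χ t u • w t := by
    funext t
    exact fderiv_smul_apply' hχ hw t u
  have hd1 : ContDiff ℝ ∞ (fun t => χ t • fderiv ℝ w t u) := hχ.smul (contDiff_fderiv_apply hw u)
  have hd2 : ContDiff ℝ ∞ (fun t => fderiv ℝ χ t u • w t) := (contDiff_fderiv_apply hχ u).smul hw
  rw [h1, fderiv_add ((hd1.differentiable (by simp)) z) ((hd2.differentiable (by simp)) z),
    add_apply]
  have e1 := fderiv_smul_apply' hχ (contDiff_fderiv_apply hw u) z v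
  have e2 := fderiv_smul_apply' (χ := (fderiv ℝ χ · u)) (contDiff_fderiv_apply hχ u) hw z v
  rw [e1, e2]

/-- The topological support of a directional derivative of `χ` lies in that of `χ`. -/
theorem tsupport_fderiv_apply_subset {χ : ℂ → ℝ} (u : ℂ) :
    tsupport (fderiv ℝ χ · u) ⊆ tsupport χ := by
  refine closure_minimal (fun z hz => ?_) (isClosed_tsupport χ)
  by_contra h
  exact hz (by simp [fderiv_eq_zero_of_notMem_tsupport h])

/-- **Step γ for one word.** For a `C^∞` map `w` with `‖w‖ ≤ c`, `‖∂ᵥw‖ ≤ b` (`v = 1, i`),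
`‖∂₂∂₁w‖ ≤ a`, and a cut-off `χ` with support in the disc of radius `ρ`, the sup bound (stub
`stub_supBound`) gives `‖χ(z₀) w(z₀)‖ ≤ (1 + C_χ + C_χ') (V + ∫_{D_ρ} a² + ∫_{D_ρ} b² + ∫_{D_ρ} c²)`. -/
theorem gamma_word
    (hS : ∀ (W : ℂ → E4), ContDiff ℝ ∞ W → HasCompactSupport W → ∀ z : ℂ,
      ‖W z‖ ≤ ∫ y, ‖fderiv ℝ (fun x => fderiv ℝ W x 1) y Complex.I‖)
    (w : ℂ → E4) (hw : ContDiff ℝ ∞ w) (χ : ℂ → ℝ) (hχ : ContDiff ℝ ∞ χ)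
    (hχc : HasCompactSupport χ) {ρ Cχ Cχ' : ℝ} (hCχ0 : 0 ≤ Cχ) (hCχ'0 : 0 ≤ Cχ')
    (hsupp : ∀ z ∈ tsupport χ, ‖z‖ ≤ ρ)
    (hχ1 : ∀ z, |χ z| ≤ 1) (hCχ : ∀ z v, ‖fderiv ℝ χ z v‖ ≤ Cχ * ‖v‖)
    (hCχ' : ∀ z, ‖fderiv ℝ (fderiv ℝ χ · 1) z Complex.I‖ ≤ Cχ')
    (a b c : ℂ → ℝ) (ha : Continuous a) (hb : Continuous b) (hc : Continuous c)
    (ha0 : ∀ z, 0 ≤ a z) (hb0 : ∀ z, 0 ≤ b z) (hc0 : ∀ z, 0 ≤ c z)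
    (hwc : ∀ z, ‖w z‖ ≤ c z) (hwb : ∀ z, ‖fderiv ℝ w z 1‖ ≤ b z ∧ ‖fderiv ℝ w z Complex.I‖ ≤ b z)
    (hwa : ∀ z, ‖fderiv ℝ (fderiv ℝ w · 1) z Complex.I‖ ≤ a z) (z₀ : ℂ) :
    ‖χ z₀ • w z₀‖ ≤ (1 + Cχ + Cχ') * ((volume (closedBall (0 : ℂ) ρ)).toReal +
      (∫ z in closedBall (0 : ℂ) ρ, a z ^ 2) + (∫ z in closedBall (0 : ℂ) ρ, b z ^ 2) +
        ∫ z in closedBall (0 : ℂ) ρ, c z ^ 2) := by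
  have hW : ContDiff ℝ ∞ (fun t => χ t • w t) := hχ.smul hw
  have hWc : HasCompactSupport (fun t => χ t • w t) := hχc.smul_right
  refine (hS _ hW hWc z₀).trans ?_
  -- the second derivative and its pointwise bound
  have hformula : ∀ z, fderiv ℝ (fun x => fderiv ℝ (fun t => χ t • w t) x 1) z Complex.I =
      χ z • fderiv ℝ (fderiv ℝ w · 1) z Complex.I + fderiv ℝ χ z Complex.I • fderiv ℝ w z 1 +
        (fderiv ℝ χ z 1 • fderiv ℝ w z Complex.I + fderiv ℝ (fderiv ℝ χ · 1) z Complex.I • w z) :=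
    fun z => fderiv_fderiv_smul hχ hw z 1 Complex.I
  have hpt : ∀ z, ‖z‖ ≤ ρ → ‖fderiv ℝ (fun x => fderiv ℝ (fun t => χ t • w t) x 1) z Complex.I‖ ≤
      (1 + Cχ + Cχ') + a z ^ 2 + Cχ * b z ^ 2 + Cχ' * c z ^ 2 := by
    intro z _
    rw [hformula]
    have t1 : ‖χ z • fderiv ℝ (fderiv ℝ w · 1) z Complex.I‖ ≤ a z := by
      rw [norm_smul, Real.norm_eq_abs]
      calc |χ z| * _ ≤ 1 * a z := mul_le_mul (hχ1 z) (hwa z) (norm_nonneg _) zero_le_one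
        _ = a z := one_mul _
    have t2 : ‖fderiv ℝ χ z Complex.I • fderiv ℝ w z 1‖ ≤ Cχ * b z := by
      rw [norm_smul]
      have := hCχ z Complex.I; rw [Complex.norm_I, mul_one] at this
      exact mul_le_mul this (hwb z).1 (norm_nonneg _) hCχ0
    have t3 : ‖fderiv ℝ χ z 1 • fderiv ℝ w z Complex.I‖ ≤ Cχ * b z := by
      rw [norm_smul]
      have := hCχ z 1; rw [norm_one, mul_one] at this
      exact mul_le_mul this (hwb z).2 (norm_nonneg _) hCχ0
    have t4 : ‖fderiv ℝ (fderiv ℝ χ · 1) z Complex.I • w z‖ ≤ Cχ' * c z := by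
      rw [norm_smul]
      exact mul_le_mul (hCχ' z) (hwc z) (norm_nonneg _) hCχ'0
    have hsum : ‖χ z • fderiv ℝ (fderiv ℝ w · 1) z Complex.I + fderiv ℝ χ z Complex.I • fderiv ℝ w z 1 +
        (fderiv ℝ χ z 1 • fderiv ℝ w z Complex.I + fderiv ℝ (fderiv ℝ χ · 1) z Complex.I • w z)‖ ≤
        a z + Cχ * b z + (Cχ * b z + Cχ' * c z) :=
      (norm_add_le _ _).trans (add_le_add ((norm_add_le _ _).trans (add_le_add t1 t2))
        ((norm_add_le _ _).trans (add_le_add t3 t4)))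
    have := ha0 z; have := hb0 z; have := hc0 z
    nlinarith [sq_nonneg (a z - 1), sq_nonneg (b z - 1), sq_nonneg (c z - 1),
      mul_nonneg hCχ0 (sq_nonneg (b z - 1)), mul_nonneg hCχ'0 (sq_nonneg (c z - 1))]
  -- off the disc everything vanishes
  have hzero : ∀ z, z ∉ closedBall (0 : ℂ) ρ →
      ‖fderiv ℝ (fun x => fderiv ℝ (fun t => χ t • w t) x 1) z Complex.I‖ = 0 := by
    intro z hz
    have hz' : z ∉ tsupport χ := fun h => hz (mem_closedBall_zero_iff.mpr (hsupp z h))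
    have h0 : χ z = 0 := image_eq_zero_of_notMem_tsupport hz'
    have h1 : fderiv ℝ χ z = 0 := fderiv_eq_zero_of_notMem_tsupport hz'
    have h2 : fderiv ℝ (fderiv ℝ χ · 1) z = 0 :=
      fderiv_eq_zero_of_notMem_tsupport fun h => hz' (tsupport_fderiv_apply_subset 1 h)
    rw [hformula, h0, h1, h2]
    simp
  have hcont : Continuous fun z => ‖fderiv ℝ (fun x => fderiv ℝ (fun t => χ t • w t) x 1) z Complex.I‖ :=
    (((contDiff_fderiv_apply hW 1).continuous_fderiv (by simp)).clm_apply continuous_const).norm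
  have iK : IntegrableOn (fun z => (1 + Cχ + Cχ') + a z ^ 2 + Cχ * b z ^ 2 + Cχ' * c z ^ 2)
      (closedBall (0 : ℂ) ρ) :=
    integrableOn_closedBall_of_continuous (((continuous_const.add (ha.pow 2)).add
      (continuous_const.mul (hb.pow 2))).add (continuous_const.mul (hc.pow 2))) 0 ρ
  have i1 : IntegrableOn (fun _ : ℂ => (1 + Cχ + Cχ' : ℝ)) (closedBall (0 : ℂ) ρ) :=
    integrableOn_closedBall_of_continuous continuous_const 0 ρ
  have ia : IntegrableOn (fun z => a z ^ 2) (closedBall (0 : ℂ) ρ) :=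
    integrableOn_closedBall_of_continuous (ha.pow 2) 0 ρ
  have ib : IntegrableOn (fun z => Cχ * b z ^ 2) (closedBall (0 : ℂ) ρ) :=
    integrableOn_closedBall_of_continuous (continuous_const.mul (hb.pow 2)) 0 ρ
  have ic : IntegrableOn (fun z => Cχ' * c z ^ 2) (closedBall (0 : ℂ) ρ) :=
    integrableOn_closedBall_of_continuous (continuous_const.mul (hc.pow 2)) 0 ρ
  have hV : ∫ _ in closedBall (0 : ℂ) ρ, (1 + Cχ + Cχ' : ℝ) =
      (volume (closedBall (0 : ℂ) ρ)).toReal * (1 + Cχ + Cχ') := by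
    rw [setIntegral_const, smul_eq_mul]; rfl
  have hIa : 0 ≤ ∫ z in closedBall (0 : ℂ) ρ, a z ^ 2 := integral_nonneg fun z => by positivity
  have hIb : 0 ≤ ∫ z in closedBall (0 : ℂ) ρ, b z ^ 2 := integral_nonneg fun z => by positivity
  have hIc : 0 ≤ ∫ z in closedBall (0 : ℂ) ρ, c z ^ 2 := integral_nonneg fun z => by positivity
  have hV0 : 0 ≤ (volume (closedBall (0 : ℂ) ρ)).toReal := ENNReal.toReal_nonneg
  calc ∫ z, ‖fderiv ℝ (fun x => fderiv ℝ (fun t => χ t • w t) x 1) z Complex.I‖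
      = ∫ z in closedBall (0 : ℂ) ρ, ‖fderiv ℝ (fun x => fderiv ℝ (fun t => χ t • w t) x 1) z Complex.I‖ :=
        integral_eq_setIntegral_of_forall hzero
    _ ≤ ∫ z in closedBall (0 : ℂ) ρ, ((1 + Cχ + Cχ') + a z ^ 2 + Cχ * b z ^ 2 + Cχ' * c z ^ 2) :=
        setIntegral_mono_on (integrableOn_closedBall_of_continuous hcont 0 ρ) iK
          measurableSet_closedBall fun z hz => hpt z (mem_closedBall_zero_iff.mp hz)
    _ = (volume (closedBall (0 : ℂ) ρ)).toReal * (1 + Cχ + Cχ') + (∫ z in closedBall (0 : ℂ) ρ, a z ^ 2) +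
          Cχ * (∫ z in closedBall (0 : ℂ) ρ, b z ^ 2) + Cχ' * ∫ z in closedBall (0 : ℂ) ρ, c z ^ 2 := by
        have iS3 : IntegrableOn (fun z => (1 + Cχ + Cχ') + a z ^ 2 + Cχ * b z ^ 2) (closedBall (0 : ℂ) ρ) :=
          integrableOn_closedBall_of_continuous ((continuous_const.add (ha.pow 2)).add
            (continuous_const.mul (hb.pow 2))) 0 ρ
        have iS2 : IntegrableOn (fun z => (1 + Cχ + Cχ') + a z ^ 2) (closedBall (0 : ℂ) ρ) :=
          integrableOn_closedBall_of_continuous (continuous_const.add (ha.pow 2)) 0 ρ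
        rw [integral_add iS3 ic, integral_add iS2 ib, integral_add i1 ia, hV,
          integral_const_mul, integral_const_mul]
    _ ≤ _ := by
        nlinarith [mul_nonneg hCχ0 hIa, mul_nonneg hCχ'0 hIa, mul_nonneg hCχ0 hIc, mul_nonneg hCχ'0 hIb,
          mul_nonneg hCχ0 hV0, mul_nonneg hCχ'0 hV0, hIb, hIc]

/-- **Step γ (sup bound from `L²` bounds of two more derivatives).** For `z` in the disc of radius
`ρ'`: `‖Dⁿg(z)‖ ≤ C (1 + ∫_{D_ρ} ‖D^{n+2}g‖² + ∫_{D_ρ} ‖D^{n+1}g‖² + ∫_{D_ρ} ‖Dⁿg‖²)` with `C`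
independent of the `C^∞` map `g`. -/
theorem gamma
    (hS : ∀ (W : ℂ → E4), ContDiff ℝ ∞ W → HasCompactSupport W → ∀ z : ℂ,
      ‖W z‖ ≤ ∫ y, ‖fderiv ℝ (fun x => fderiv ℝ W x 1) y Complex.I‖)
    (hB : ∀ (n : ℕ) (T : ContinuousMultilinearMap ℝ (fun _ : Fin n => ℂ) E4),
      ‖T‖ ≤ ∑ L : Fin n → Fin 2, ‖T (fun j => ![(1 : ℂ), Complex.I] (L j))‖)
    (n : ℕ) {ρ' ρ : ℝ} (hρ' : 0 < ρ') (hρ'ρ : ρ' < ρ) :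
    ∃ C : ℝ, ∀ g : ℂ → E4, ContDiff ℝ ∞ g → ∀ z ∈ closedBall (0 : ℂ) ρ',
      ‖iteratedFDeriv ℝ n g z‖ ≤
        C * (1 + (∫ z in closedBall (0 : ℂ) ρ, ‖iteratedFDeriv ℝ (n + 2) g z‖ ^ 2) +
          (∫ z in closedBall (0 : ℂ) ρ, ‖iteratedFDeriv ℝ (n + 1) g z‖ ^ 2) +
          ∫ z in closedBall (0 : ℂ) ρ, ‖iteratedFDeriv ℝ n g z‖ ^ 2) := by
  let χ : ContDiffBump (0 : ℂ) := ⟨(2 * ρ' + ρ) / 3, (ρ' + 2 * ρ) / 3, by linarith, by linarith⟩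
  have hχIn : ρ' < χ.rIn := by show ρ' < (2 * ρ' + ρ) / 3; linarith
  have hχOut : χ.rOut < ρ := by show (ρ' + 2 * ρ) / 3 < ρ; linarith
  have hχc : ContDiff ℝ ∞ (χ : ℂ → ℝ) := χ.contDiff
  have hχs : HasCompactSupport (χ : ℂ → ℝ) := χ.hasCompactSupport
  obtain ⟨Cχ, hCχ⟩ : ∃ C, ∀ z, ‖fderiv ℝ (χ : ℂ → ℝ) z‖ ≤ C :=
    (hχs.fderiv (𝕜 := ℝ)).exists_bound_of_continuous (hχc.continuous_fderiv (by simp))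
  have hCχ0 : 0 ≤ Cχ := (norm_nonneg _).trans (hCχ 0)
  have hCχv : ∀ z v, ‖fderiv ℝ (χ : ℂ → ℝ) z v‖ ≤ Cχ * ‖v‖ := fun z v =>
    (ContinuousLinearMap.le_opNorm _ _).trans (mul_le_mul_of_nonneg_right (hCχ z) (norm_nonneg _))
  have hχd : ContDiff ℝ ∞ (fderiv ℝ (χ : ℂ → ℝ) · 1) := contDiff_fderiv_apply hχc 1
  have hχds : HasCompactSupport (fderiv ℝ (χ : ℂ → ℝ) · 1) :=
    hasCompactSupport_of_eq_zero hχs fun z hz => by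
      simp [fderiv_eq_zero_of_notMem_tsupport hz]
  obtain ⟨Cχ', hCχ'⟩ : ∃ C, ∀ z, ‖fderiv ℝ (fderiv ℝ (χ : ℂ → ℝ) · 1) z‖ ≤ C :=
    (hχds.fderiv (𝕜 := ℝ)).exists_bound_of_continuous (hχd.continuous_fderiv (by simp))
  have hCχ'0 : 0 ≤ Cχ' := (norm_nonneg _).trans (hCχ' 0)
  have hCχ'I : ∀ z, ‖fderiv ℝ (fderiv ℝ (χ : ℂ → ℝ) · 1) z Complex.I‖ ≤ Cχ' := fun z =>
    (ContinuousLinearMap.le_opNorm _ _).trans (by rw [Complex.norm_I, mul_one]; exact hCχ' z)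
  have hχ1 : ∀ z, |(χ : ℂ → ℝ) z| ≤ 1 := fun z => by
    rw [abs_of_nonneg χ.nonneg]; exact χ.le_one
  have hsuppχ : ∀ z ∈ tsupport (χ : ℂ → ℝ), ‖z‖ ≤ ρ := by
    intro z hz
    rw [χ.tsupport_eq] at hz
    exact (mem_closedBall_zero_iff.mp hz).trans hχOut.le
  obtain ⟨V, hV⟩ : ∃ V : ℝ, V = (volume (closedBall (0 : ℂ) ρ)).toReal := ⟨_, rfl⟩
  have hV0 : 0 ≤ V := by rw [hV]; exact ENNReal.toReal_nonneg
  refine ⟨(2 : ℝ) ^ n * ((1 + Cχ + Cχ') * (V + 1)), fun g hg z hz => ?_⟩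
  obtain ⟨Ia, hIa⟩ : ∃ I : ℝ, I = ∫ z in closedBall (0 : ℂ) ρ, ‖iteratedFDeriv ℝ (n + 2) g z‖ ^ 2 :=
    ⟨_, rfl⟩
  obtain ⟨Ib, hIb⟩ : ∃ I : ℝ, I = ∫ z in closedBall (0 : ℂ) ρ, ‖iteratedFDeriv ℝ (n + 1) g z‖ ^ 2 :=
    ⟨_, rfl⟩
  obtain ⟨Ic, hIc⟩ : ∃ I : ℝ, I = ∫ z in closedBall (0 : ℂ) ρ, ‖iteratedFDeriv ℝ n g z‖ ^ 2 :=
    ⟨_, rfl⟩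
  have hIa0 : 0 ≤ Ia := by rw [hIa]; exact integral_nonneg fun z => by positivity
  have hIb0 : 0 ≤ Ib := by rw [hIb]; exact integral_nonneg fun z => by positivity
  have hIc0 : 0 ≤ Ic := by rw [hIc]; exact integral_nonneg fun z => by positivity
  rw [← hIa, ← hIb, ← hIc]
  have hac : ∀ k, Continuous fun z => ‖iteratedFDeriv ℝ k g z‖ := fun k =>
    (hg.continuous_iteratedFDeriv (m := k) (by exact_mod_cast le_top)).norm
  have hχz : (χ : ℂ → ℝ) z = 1 :=
    χ.one_of_mem_closedBall (mem_closedBall_zero_iff.mpr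
      ((mem_closedBall_zero_iff.mp hz).trans hχIn.le) |> fun h => by simpa using h)
  -- per word
  have key : ∀ L : Fin n → Fin 2,
      ‖iteratedFDeriv ℝ n g z (fun j => ![(1 : ℂ), Complex.I] (L j))‖ ≤
        (1 + Cχ + Cχ') * (V + Ia + Ib + Ic) := by
    intro L
    have hw : ContDiff ℝ ∞ (iteratedFDeriv ℝ n g · (fun j => ![(1 : ℂ), Complex.I] (L j))) :=
      contDiff_iteratedFDeriv_apply hg n _
    have h := gamma_word hS _ hw χ hχc hχs hCχ0 hCχ'0 hsuppχ hχ1 hCχv hCχ'I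
      (fun z => ‖iteratedFDeriv ℝ (n + 2) g z‖) (fun z => ‖iteratedFDeriv ℝ (n + 1) g z‖)
      (fun z => ‖iteratedFDeriv ℝ n g z‖) (hac _) (hac _) (hac _)
      (fun z => norm_nonneg _) (fun z => norm_nonneg _) (fun z => norm_nonneg _)
      (fun z => norm_iteratedFDeriv_apply_basis_le g n L z)
      (fun z => ⟨by simpa using norm_fderiv_word_le hg n L 0 z,
        by simpa using norm_fderiv_word_le hg n L 1 z⟩)
      (fun z => by simpa using norm_fderiv_fderiv_word_le hg n L 1 0 z) z
    rw [← hV, ← hIa, ← hIb, ← hIc, hχz, one_smul] at h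
    exact h
  have hcard : ((Finset.univ : Finset (Fin n → Fin 2)).card : ℝ) = 2 ^ n := by simp
  calc ‖iteratedFDeriv ℝ n g z‖ ≤ ∑ L : Fin n → Fin 2,
        ‖iteratedFDeriv ℝ n g z (fun j => ![(1 : ℂ), Complex.I] (L j))‖ := hB n _
    _ ≤ ∑ L : Fin n → Fin 2, (1 + Cχ + Cχ') * (V + Ia + Ib + Ic) := Finset.sum_le_sum fun L _ => key L
    _ = (2 : ℝ) ^ n * ((1 + Cχ + Cχ') * (V + Ia + Ib + Ic)) := by
        rw [Finset.sum_const, Finset.card_univ, ← Finset.card_univ, nsmul_eq_mul, hcard]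
    _ ≤ (2 : ℝ) ^ n * ((1 + Cχ + Cχ') * (V + 1)) * (1 + Ia + Ib + Ic) := by
        have h0 : V + Ia + Ib + Ic ≤ (V + 1) * (1 + Ia + Ib + Ic) := by nlinarith
        have h1 : 0 ≤ (1 + Cχ + Cχ') := by positivity
        have h2 := mul_le_mul_of_nonneg_left h0 h1
        have h3 := mul_le_mul_of_nonneg_left h2 (pow_nonneg zero_le_two n)
        nlinarith [h3]

end Gamma

end Apriori

end Summit.SmoothPoincare4.SmoothPoincare4.Cruxes.TameOrBrodyR4.Sketch
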